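/-
Copyright: derived here (Resolution Observatory cell `pub-rosobs`, carver gen 57). AI-written Lean; AI review is weaker than expert
review.  Companion file of the cell's POLYNOMIAL weighted-centre model `W(f)`: the HENSEL BRANCH of engine 1's LEMMA FC (B1) and the
injectivity `B′ ↪ K⟦s⟧` transporting (B2) "`u_k ≠ 0` for `m ∤ k`" to `K⟦s⟧` — hypothesis (U) of the word induction (B5)
(THEOREM-FC-eng1-g37 §4 (B1), (B2), (B5); CARVER-NOTES-eng1-g37 T48; README-g56 §4 ask (a)).
Instrument — NOT a resolution theorem and NOT a statement about the invariant of [AbramovichTemkinWlodarczyk2024].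
-/
import Literature.AlgebraicGeometry.Resolution.WeightedCentreFermatComposition
import Mathlib.RingTheory.Henselian
import Mathlib.RingTheory.AdicCompletion.Completeness
import Mathlib.RingTheory.PowerSeries.Inverse
import Mathlib.RingTheory.PowerSeries.NoZeroDivisors
import Mathlib.RingTheory.Ideal.GoingUp
import Mathlib.Algebra.Polynomial.Taylor
import Mathlib.Algebra.Polynomial.Div
import Mathlib.Algebra.Module.Torsion.Free
import Mathlib.Data.Fin.VecNotation
import Mathlib.Tactic.LinearCombination
import HarnessLib

/-!
# The Hensel branch `t(s)` of the Fermat curve and `B′ = K[t][s]/(1 + t^m + s^m) ↪ K⟦s⟧`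

Uniform value line: INSTRUMENT — kernel-checked commutative algebra for the polynomial weighted-centre model `W(f)` of the cell
(engine 1's toy model: THEOREM-FC-eng1-g37 §4, LEMMA FC (B1)/(B2)/(B5)) — NOT a resolution theorem, NOT a statement about the
Abramovich–Temkin–Włodarczyk invariant, NOT summit progress; AI-written Lean, AI review is weaker than expert review.

Setting of `WeightedCentreFermatComposition`: `K` a field, `K[t][s] = K[X][X]` (inner variable `t`, outer `s`),
`fermat m = s^m + (1 + t^m)`, `B′ = AdjoinRoot (fermat m)` with `t = of _ X`, `s = root _`, and `u_k = mk _ (fermat k) = 1 + t^k + s^k`.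

* **(B1) the branch** (`exists_branch`, `exists_branch_of_odd`): for `0 < m`, `(m : K) ≠ 0` and `a^m = −1` (e.g. `a = −1`, `m` odd)
  there is `t ∈ K⟦s⟧` with `t(0) = a` and `t^m + (1 + s^m) = 0` — Hensel's lemma in the `s`-adically complete ring `K⟦s⟧`
  (Mathlib `IsAdicComplete.henselianRing`) for the monic `Y^m + (1 + s^m)`, simple root `a` mod `s`; such a `t` is not a constant
  (`ne_C_constantCoeff_of_branch`).
* **non-constant power series are transcendental over `K`** (`aeval_injective`; elementary: shift by the constant term with
  `Polynomial.taylor`, then a root `δ ∈ (s) ∖ 0` of `Y^n q(Y)`, `q(0) ≠ 0`, is impossible in the domain `K⟦s⟧`).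
* **the branch homomorphism** `branchHom t ht : B′ → K⟦s⟧`, `t ↦ t(s)`, `s ↦ s` (`AdjoinRoot.lift`), with
  `branchHom_mk_fermat : u_k ↦ s^k + (1 + t^k)`; it is **INJECTIVE when `B′` is a domain** (`branchHom_injective`): its kernel is a
  prime of the integral extension `K[t] ⊂ B′` (`fermat m` monic ⇒ `Module.Finite`) lying over `ker (t ↦ t(s)) = 0`, hence `= 0`
  (Mathlib `Ideal.eq_bot_of_comap_eq_bot`).  The domain hypothesis is the instance argument
  `[IsDomain (AdjoinRoot (fermat m))]`, discharged for `(m : K) ≠ 0` by `FermatDomain.isDomain_adjoinRoot_fermat` of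
  `WeightedCentreFermatIrreducible` (not imported here only because of build ordering; `fermat_def` is `rfl`).
* **(B2) in `K⟦s⟧`** (`powerSum_ne_zero`): `s^k + (1 + t^k) ≠ 0` for `m ∤ k` (from `FermatComposition.mk_fermat_ne_zero` and
  injectivity), while in characteristic `p`, `s^{m p^e} + (1 + t^{m p^e}) = 0` (`powerSum_eq_zero_of_charP`, no domain hypothesis);
* **(U) and (B5)**: `u_k = powerSum ![1, t, s] k` is regular on every torsion-free `K⟦s⟧`-module for `m ∤ k`
  (`isSMulRegular_powerSum`; and `isSMulRegular_mk_fermat` is the `B′`-module form BY NAME), so the word induction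
  `FermatComposition.map_eq_zero_of_orderComp_eq_zero` applies with `l = (1, t(s), s)`: `map_eq_zero_of_orderComp_eq_zero`.

What is NOT here (engine 1's modelling): LEMMA CP / PR″ and the free hypotheses giving `Θ = id` (B3)–(B4), i.e. the relations
`(E_k)`, and the re-grading conclusion (B6).

Pattern cites: Hensel's lemma in complete rings [cite: Matsumura1987, Thm 8.3]; primes of an integral extension lying over `0`
[cite: Matsumura1987, Thm 9.3]; Euclidean bookkeeping [cite: Lang2002, Ch. IV §1].  Formalisation and statements ours, elementary.
-/

namespace Literature.AlgebraicGeometry.Resolution.WeightedBlowup.FermatBranch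

open Polynomial

/-! ## Non-constant power series are transcendental over the constants -/

section Transcendental

variable {K : Type*} [CommRing K] [IsDomain K]

omit [IsDomain K] in
/-- For `δ ∈ (s)`, the constant term of `q(δ)` is `q(0)` (plumbing). [cite: Lang2002, Ch. IV §1] -/
theorem constantCoeff_aeval {δ : PowerSeries K} (hδ : PowerSeries.constantCoeff δ = 0) (q : K[X]) :
    PowerSeries.constantCoeff (aeval δ q) = q.coeff 0 := by
  have h : PowerSeries.constantCoeff.comp (algebraMap K (PowerSeries K)) = RingHom.id K :=
    RingHom.ext fun c => by
      rw [RingHom.comp_apply, PowerSeries.algebraMap_eq, PowerSeries.constantCoeff_C, RingHom.id_apply]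
  rw [aeval_def, hom_eval₂, hδ, coeff_zero_eq_eval_zero, ← eval₂_id, h]

/-- A non-zero `δ ∈ (s) ⊂ K⟦s⟧` is a root of no non-zero polynomial over `K` (ours, elementary: `Q = Y^n q`, `q(0) ≠ 0`, and
`q(δ)(0) = q(0)`). [cite: Lang2002, Ch. IV §1] -/
theorem aeval_ne_zero_of_constantCoeff_eq_zero {δ : PowerSeries K} (hδ0 : PowerSeries.constantCoeff δ = 0) (hδ : δ ≠ 0)
    {Q : K[X]} (hQ : Q ≠ 0) : aeval δ Q ≠ 0 := by
  obtain ⟨q, hQq, hq⟩ := Q.exists_eq_pow_rootMultiplicity_mul_and_not_dvd hQ 0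
  rw [map_zero, sub_zero] at hQq hq
  rw [Polynomial.X_dvd_iff] at hq
  intro h
  rw [hQq, map_mul, map_pow, aeval_X] at h
  rcases mul_eq_zero.mp h with h1 | h1
  · exact hδ (eq_zero_of_pow_eq_zero h1)
  · exact hq (by rw [← constantCoeff_aeval hδ0 q, h1, map_zero])

/-- **Non-constant power series are transcendental over `K`** (ours, elementary): if `t ∈ K⟦s⟧` is not the constant `t(0)`, then
`Q ↦ Q(t)`, `K[Y] → K⟦s⟧`, is injective. [cite: Lang2002, Ch. IV §1] -/
theorem aeval_injective {t : PowerSeries K} (ht : t ≠ PowerSeries.C (PowerSeries.constantCoeff t)) :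
    Function.Injective (aeval t : K[X] →ₐ[K] PowerSeries K) := by
  rw [injective_iff_map_eq_zero]
  intro Q hQ
  by_contra hQ0
  have hδ0 : PowerSeries.constantCoeff (t - PowerSeries.C (PowerSeries.constantCoeff t)) = 0 := by
    rw [map_sub, PowerSeries.constantCoeff_C, sub_self]
  have hT : taylor (PowerSeries.constantCoeff t) Q ≠ 0 := fun h =>
    hQ0 (taylor_injective (PowerSeries.constantCoeff t) (by rw [h, map_zero]))
  refine aeval_ne_zero_of_constantCoeff_eq_zero hδ0 (sub_ne_zero.mpr ht) hT ?_
  rw [taylor_apply, aeval_comp, map_add, aeval_X, aeval_C, PowerSeries.algebraMap_eq, sub_add_cancel, hQ]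

end Transcendental

section Branch

variable {K : Type*} [Field K]

/-! ## (B1) The Hensel branch -/

/-- **LEMMA FC (B1), the branch** (ours): for `0 < m`, `(m : K) ≠ 0` and `a ∈ K` with `a^m = −1` there is `t ∈ K⟦s⟧` with constant
term `a` and `t^m + (1 + s^m) = 0` — Hensel's lemma in the `s`-adically complete `K⟦s⟧` for the monic `Y^m + (1 + s^m)` at the simple
root `a` modulo `s`. [cite: Matsumura1987, Thm 8.3] -/
theorem exists_branch {m : ℕ} (hm : 0 < m) (hmK : (m : K) ≠ 0) {a : K} (ha : a ^ m = -1) :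
    ∃ t : PowerSeries K, PowerSeries.constantCoeff t = a ∧ t ^ m + (1 + PowerSeries.X ^ m) = 0 := by
  classical
  have ha0 : a ≠ 0 := by
    rintro rfl
    rw [zero_pow hm.ne'] at ha
    exact one_ne_zero (neg_eq_zero.mp ha.symm)
  have hH := (IsAdicComplete.henselianRing (PowerSeries K) (Ideal.span {PowerSeries.X})).is_henselian
    (X ^ m + C (1 + PowerSeries.X ^ m)) (monic_X_pow_add_C _ hm.ne') (PowerSeries.C a) ?_ ?_
  · obtain ⟨t, ht, htI⟩ := hH
    refine ⟨t, ?_, ?_⟩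
    · rwa [Ideal.mem_span_singleton, PowerSeries.X_dvd_iff, map_sub, PowerSeries.constantCoeff_C, sub_eq_zero] at htI
    · have h := ht.eq_zero
      rwa [eval_add, eval_pow, eval_X, eval_C] at h
  · rw [Ideal.mem_span_singleton, eval_add, eval_pow, eval_X, eval_C, ← map_pow, ha, map_neg, map_one, neg_add_cancel_left]
    exact dvd_pow_self _ hm.ne'
  · refine IsUnit.map _ ?_
    rw [derivative_add, derivative_C, add_zero, derivative_X_pow, eval_mul, eval_pow, eval_X, eval_C,
      PowerSeries.isUnit_iff_constantCoeff, map_mul, map_pow, PowerSeries.constantCoeff_C, map_natCast]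
    exact isUnit_iff_ne_zero.mpr (mul_ne_zero hmK (pow_ne_zero _ ha0))

/-- The cell's case: `m` odd, `(m : K) ≠ 0` ⇒ a branch `t(s)` with `t(0) = −1` and `t^m = −(1 + s^m)` (ours).
[cite: Matsumura1987, Thm 8.3] -/
theorem exists_branch_of_odd {m : ℕ} (hm : Odd m) (hmK : (m : K) ≠ 0) :
    ∃ t : PowerSeries K, PowerSeries.constantCoeff t = -1 ∧ t ^ m + (1 + PowerSeries.X ^ m) = 0 :=
  exists_branch hm.pos hmK hm.neg_one_pow

/-- A branch is not a constant: compare the `s^m`-coefficients of `t^m = −(1 + s^m)` (ours, bookkeeping). [cite: Lang2002, Ch. IV §1] -/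
theorem ne_C_constantCoeff_of_branch {m : ℕ} (hm : 0 < m) {t : PowerSeries K} (ht : t ^ m + (1 + PowerSeries.X ^ m) = 0) :
    t ≠ PowerSeries.C (PowerSeries.constantCoeff t) := by
  intro h
  have h1 := congr_arg (PowerSeries.coeff m) ht
  rw [h, ← map_pow] at h1
  simp only [map_add, PowerSeries.coeff_C, PowerSeries.coeff_one, PowerSeries.coeff_X_pow_self, if_neg hm.ne', map_zero,
    zero_add] at h1
  exact one_ne_zero h1

/-! ## The branch homomorphism `B′ → K⟦s⟧` -/

/-- The substitution `t ↦ t(s)`, `s ↦ s` sends `fermat m = s^m + (1 + t^m)` to `s^m + (1 + t(s)^m)` (plumbing).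
[cite: Lang2002, Ch. IV §1] -/
theorem eval₂_fermat (m : ℕ) (t : PowerSeries K) :
    (FermatComposition.fermat m : K[X][X]).eval₂ (aeval t : K[X] →ₐ[K] PowerSeries K).toRingHom PowerSeries.X =
      PowerSeries.X ^ m + (1 + t ^ m) := by
  rw [FermatComposition.fermat_def, eval₂_add, eval₂_pow, eval₂_X, eval₂_C, AlgHom.toRingHom_eq_coe, RingHom.coe_coe,
    map_add, map_one, map_pow, aeval_X]

/-- … which vanishes on a branch (plumbing). [cite: Lang2002, Ch. IV §1] -/
theorem eval₂_fermat_eq_zero {m : ℕ} {t : PowerSeries K} (ht : t ^ m + (1 + PowerSeries.X ^ m) = 0) :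
    (FermatComposition.fermat m : K[X][X]).eval₂ (aeval t : K[X] →ₐ[K] PowerSeries K).toRingHom PowerSeries.X = 0 := by
  rw [eval₂_fermat]
  linear_combination ht

/-- The **branch homomorphism** `φ̄ : B′ = K[t][s]/(fermat m) → K⟦s⟧`, `t ↦ t(s)`, `s ↦ s`, for a branch `t` (ours).
[cite: Lang2002, Ch. IV §1] -/
noncomputable def branchHom {m : ℕ} (t : PowerSeries K) (ht : t ^ m + (1 + PowerSeries.X ^ m) = 0) :
    AdjoinRoot (FermatComposition.fermat m : K[X][X]) →+* PowerSeries K :=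
  AdjoinRoot.lift (aeval t : K[X] →ₐ[K] PowerSeries K).toRingHom PowerSeries.X (eval₂_fermat_eq_zero ht)

/-- `φ̄` on `K[t]`: `g(t) ↦ g(t(s))` (plumbing). [cite: Lang2002, Ch. IV §1] -/
theorem branchHom_of {m : ℕ} (t : PowerSeries K) (ht : t ^ m + (1 + PowerSeries.X ^ m) = 0) (g : K[X]) :
    branchHom t ht (AdjoinRoot.of _ g) = aeval t g := by
  rw [branchHom, AdjoinRoot.lift_of]
  rfl

/-- `φ̄ ∘ (K[t] → B′) = (t ↦ t(s))` (plumbing). [cite: Lang2002, Ch. IV §1] -/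
theorem branchHom_comp_of {m : ℕ} (t : PowerSeries K) (ht : t ^ m + (1 + PowerSeries.X ^ m) = 0) :
    (branchHom t ht).comp (AdjoinRoot.of _) = (aeval t : K[X] →ₐ[K] PowerSeries K).toRingHom :=
  AdjoinRoot.lift_comp_of _

/-- `φ̄ s = s` (plumbing). [cite: Lang2002, Ch. IV §1] -/
theorem branchHom_root {m : ℕ} (t : PowerSeries K) (ht : t ^ m + (1 + PowerSeries.X ^ m) = 0) :
    branchHom t ht (AdjoinRoot.root _) = PowerSeries.X :=
  AdjoinRoot.lift_root _

/-- `φ̄` on classes (plumbing). [cite: Lang2002, Ch. IV §1] -/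
theorem branchHom_mk {m : ℕ} (t : PowerSeries K) (ht : t ^ m + (1 + PowerSeries.X ^ m) = 0) (g : K[X][X]) :
    branchHom t ht (AdjoinRoot.mk _ g) = g.eval₂ (aeval t : K[X] →ₐ[K] PowerSeries K).toRingHom PowerSeries.X :=
  AdjoinRoot.lift_mk _ g

/-- `φ̄ (u_k) = s^k + (1 + t(s)^k)` — the constants `u_k` of LEMMA FC in `K⟦s⟧` (ours). [cite: Lang2002, Ch. IV §1] -/
theorem branchHom_mk_fermat {m : ℕ} (t : PowerSeries K) (ht : t ^ m + (1 + PowerSeries.X ^ m) = 0) (k : ℕ) :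
    branchHom t ht (AdjoinRoot.mk _ (FermatComposition.fermat k)) = PowerSeries.X ^ k + (1 + t ^ k) := by
  rw [branchHom_mk, eval₂_fermat]

/-- **`B′ ↪ K⟦s⟧`** (ours): if `B′ = K[t][s]/(fermat m)` is a domain (`WeightedCentreFermatIrreducible` for `(m : K) ≠ 0`), the branch
homomorphism is INJECTIVE — its kernel is a prime of the integral extension `K[t] ⊂ B′` lying over `ker (g ↦ g(t(s))) = 0`
(`aeval_injective`), hence zero. [cite: Matsumura1987, Thm 9.3] -/
theorem branchHom_injective {m : ℕ} (hm : 0 < m) {t : PowerSeries K} (ht : t ^ m + (1 + PowerSeries.X ^ m) = 0)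
    [IsDomain (AdjoinRoot (FermatComposition.fermat m : K[X][X]))] : Function.Injective (branchHom t ht) := by
  haveI : Module.Finite K[X] (AdjoinRoot (FermatComposition.fermat m : K[X][X])) :=
    (FermatComposition.fermat_monic hm).finite_adjoinRoot
  haveI : Algebra.IsIntegral K[X] (AdjoinRoot (FermatComposition.fermat m : K[X][X])) :=
    Algebra.IsIntegral.of_finite K[X] _
  rw [RingHom.injective_iff_ker_eq_bot]
  refine Ideal.eq_bot_of_comap_eq_bot (R := K[X]) ?_
  rw [AdjoinRoot.algebraMap_eq, RingHom.comap_ker, branchHom_comp_of, ← RingHom.injective_iff_ker_eq_bot]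
  exact aeval_injective (ne_C_constantCoeff_of_branch hm ht)

/-! ## (B2) in `K⟦s⟧` and hypothesis (U) -/

/-- **LEMMA FC (B2) in `K⟦s⟧`** (ours): for a branch `t` and `m ∤ k`, `u_k = s^k + (1 + t^k) ≠ 0` in `K⟦s⟧` (`B′` a domain).
[cite: Lang2002, Ch. IV §1] -/
theorem powerSum_ne_zero {m : ℕ} (hm : 0 < m) {t : PowerSeries K} (ht : t ^ m + (1 + PowerSeries.X ^ m) = 0)
    [IsDomain (AdjoinRoot (FermatComposition.fermat m : K[X][X]))] {k : ℕ} (hmk : ¬ m ∣ k) :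
    PowerSeries.X ^ k + (1 + t ^ k) ≠ 0 := by
  rw [← branchHom_mk_fermat t ht k]
  exact fun h => FermatComposition.mk_fermat_ne_zero hm hmk (branchHom_injective hm ht (by rw [h, map_zero]))

/-- … while in characteristic `p`, `u_{m p^e} = s^{m p^e} + (1 + t^{m p^e}) = 0` for every `e` (ours; Frobenius, no domain
hypothesis). [cite: Lang2002, Ch. IV §1] -/
theorem powerSum_eq_zero_of_charP (p : ℕ) [Fact p.Prime] [CharP K p] {m : ℕ} {t : PowerSeries K}
    (ht : t ^ m + (1 + PowerSeries.X ^ m) = 0) (e : ℕ) :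
    PowerSeries.X ^ (m * p ^ e) + (1 + t ^ (m * p ^ e)) = 0 := by
  rw [← branchHom_mk_fermat t ht, FermatComposition.mk_fermat_mul_char_pow, map_zero]

/-- Dictionary: with `l = (1, t(s), s)` the power sum `FermatComposition.powerSum l k` is `u_k = s^k + (1 + t^k)` (plumbing).
[cite: Lang2002, Ch. IV §1] -/
theorem powerSum_eq (t : PowerSeries K) (k : ℕ) :
    FermatComposition.powerSum ![1, t, PowerSeries.X] k = PowerSeries.X ^ k + (1 + t ^ k) := by
  simp only [FermatComposition.powerSum, Fin.sum_univ_three, Matrix.cons_val_zero, Matrix.cons_val_one,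
    Matrix.cons_val_two, Matrix.tail_cons, Matrix.head_cons, one_pow]
  ring

/-- **Hypothesis (U) of LEMMA FC (B5) in `K⟦s⟧`** (ours): for a branch `t`, `B′` a domain and `m ∤ k`, `u_k` is regular on every
torsion-free `K⟦s⟧`-module (cell: `M = K⟦s⟧[ε]`). [cite: Lang2002, Ch. IV §1] -/
theorem isSMulRegular_powerSum {m : ℕ} (hm : 0 < m) {t : PowerSeries K} (ht : t ^ m + (1 + PowerSeries.X ^ m) = 0)
    [IsDomain (AdjoinRoot (FermatComposition.fermat m : K[X][X]))] {M : Type*} [AddCommGroup M]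
    [Module (PowerSeries K) M] [Module.IsTorsionFree (PowerSeries K) M] {k : ℕ} (hmk : ¬ m ∣ k) :
    IsSMulRegular M (FermatComposition.powerSum ![1, t, PowerSeries.X] k) := by
  rw [powerSum_eq]
  exact IsSMulRegular.of_ne_zero (powerSum_ne_zero hm ht hmk)

/-- **Hypothesis (U) in `B′` by name** (ours; README-g56 §4 ask (a)): `B′ = AdjoinRoot (fermat m)` a domain, `m ∤ k` ⇒
`u_k = mk _ (fermat k)` is regular on every torsion-free `B′`-module (`FermatComposition.mk_fermat_ne_zero`). [cite: Lang2002, Ch. IV §1] -/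
theorem isSMulRegular_mk_fermat {m : ℕ} (hm : 0 < m) [IsDomain (AdjoinRoot (FermatComposition.fermat m : K[X][X]))]
    {M : Type*} [AddCommGroup M] [Module (AdjoinRoot (FermatComposition.fermat m : K[X][X])) M]
    [Module.IsTorsionFree (AdjoinRoot (FermatComposition.fermat m : K[X][X])) M] {k : ℕ} (hmk : ¬ m ∣ k) :
    IsSMulRegular M (AdjoinRoot.mk (FermatComposition.fermat m : K[X][X]) (FermatComposition.fermat k)) :=
  IsSMulRegular.of_ne_zero (FermatComposition.mk_fermat_ne_zero hm hmk)

/-- **LEMMA FC (B5) with (U) discharged** (ours): additive operators `E k` (`E 0 = id`) on `N`, an injective additive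
`ι : N → M` into a torsion-free `K⟦s⟧`-module, a branch `t` with `B′` a domain; if the order-`k` components of the triple
composite with scalars `(1, t(s), s)` vanish for all `k ∉ mℕ`, then `E k = 0` for all `k ∉ mℕ`. [cite: Matsumura1987, §27 (pp. 207–209)] -/
theorem map_eq_zero_of_orderComp_eq_zero {m : ℕ} (hm : 0 < m) {t : PowerSeries K}
    (ht : t ^ m + (1 + PowerSeries.X ^ m) = 0) [IsDomain (AdjoinRoot (FermatComposition.fermat m : K[X][X]))]
    {M : Type*} [AddCommGroup M] [Module (PowerSeries K) M] [Module.IsTorsionFree (PowerSeries K) M]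
    {N : Type*} [AddCommMonoid N] {E : ℕ → N →+ N} (hE0 : E 0 = AddMonoidHom.id N) {ι : N →+ M}
    (hι : Function.Injective ι)
    (hrel : ∀ k, ¬ m ∣ k → ∀ f, FermatComposition.orderComp E ![1, t, PowerSeries.X] ι k f = 0) :
    ∀ k, ¬ m ∣ k → E k = 0 :=
  FermatComposition.map_eq_zero_of_orderComp_eq_zero hE0 hι hrel fun _ hmk => isSMulRegular_powerSum hm ht hmk

/-- **LEMMA FC (B1) packaged** (ours): `m` odd, `(m : K) ≠ 0`, `B′` a domain ⇒ there is a branch `t ∈ K⟦s⟧`, `t(0) = −1`,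
`t^m = −(1 + s^m)`, along which `u_k = s^k + (1 + t^k) ≠ 0` for every `k ∉ mℕ`. [cite: Matsumura1987, Thm 8.3] -/
theorem exists_branch_powerSum_ne_zero {m : ℕ} (hm : Odd m) (hmK : (m : K) ≠ 0)
    [IsDomain (AdjoinRoot (FermatComposition.fermat m : K[X][X]))] :
    ∃ t : PowerSeries K, PowerSeries.constantCoeff t = -1 ∧ t ^ m + (1 + PowerSeries.X ^ m) = 0 ∧
      ∀ k, ¬ m ∣ k → PowerSeries.X ^ k + (1 + t ^ k) ≠ 0 := by
  obtain ⟨t, ht0, ht⟩ := exists_branch_of_odd hm hmK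
  exact ⟨t, ht0, ht, fun _ hmk => powerSum_ne_zero hm.pos ht hmk⟩

end Branch

end Literature.AlgebraicGeometry.Resolution.WeightedBlowup.FermatBranch
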